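import Summits.BirchSwinnertonDyer.BirchSwinnertonDyer.Theorems.AdditiveKolyvaginRoadManinFrameResidueProperRTameTwistFull57
import Summits.BirchSwinnertonDyer.BirchSwinnertonDyer.Theorems.AdditiveKolyvaginRoadManinFrameTransport
import Literature.NumberTheory.EllipticCurves.ManinConstantQuadraticTwistStevensHoldsProofs
import Literature.NumberTheory.EllipticCurves.BurungaleSkinnerTianWan2024.CyclotomicPConverseOverQProofs
import HarnessLib

/-!
# Route `EdixhovenFibreFiveSeven`, crux TDS57 (stmt-BirchSwinnertonDyer-22227): the Kosters–Pannekoek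
# sub-residue by an AUXILIARY UNIT TWIST — Manin's `p`-part at a lattice-optimal datum from the tame-twist
# lever on the twisted class, Stevens' Néron-lattice lemma, and ONE twisted-period decomposition (`--supports`)

Cell `pub/bsd-wall` (D-0145 line `route-BirchSwinnertonDyer-EdixhovenFibreFiveSeven`), seat `bsd-line-edix-p2`
(prover). THEOREMS ONLY (no definition, no named fact, no `sorry`); ROUTE-FREE (no `Theses` import). Nothing is
closed and BSD is not proved by this file.

CONTEXT. By `Theorems/EdixhovenFibreFiveSevenTwistDegreeStepFiveSeven.lean` (p581738/p582423) the crux TDS57 is,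
GRANTED F″ = `kato_neron_isIntegral_twistedSymbolSum_of_additive_five_le` (+ ČNS, Cremona by name), reduced to
KP57♯: Manin's `p`-part (`p ∈ {5, 7}`, some conductor-level datum) for the unstarred additive curves `V` with
`E[p]` irreducible whose isogeny class carries a `ℚ_p`-RATIONAL POINT OF ORDER `p` (Kosters–Pannekoek: there the
receptacle `exp*(H¹/H¹_f) = O_K ω_E` of Kim–Nakamura fails and the lever `not_dvd_c_of_tameTwist57` does not
apply). THIS FILE is the repair by an auxiliary quadratic twist `χ = χ_{q*}`, `q` an odd prime with `q ∤ N` and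
`(q*/p) = −1`: the twisted class `E ⊗ χ` has NO `ℚ_p`-rational `p`-torsion (a common fixed line of `E[p]` and
`E[p] ⊗ χ` under `G_{ℚ_p}` would force `χ|G_{ℚ_p} = 1`, and independent fixed lines would force
`det ρ̄|G_{ℚ_p} = χ`, but `det ρ̄ = ω` is onto `𝔽_p^×`), so the lever applies to the `X₀(Nq²)`-optimal curve of
the twisted class; Stevens 1989 Lemma (5.2) (`Λ(E^χ) = g(χ)⁻¹ Λ(E)`, a TREE THEOREM) carries the resulting
Manin-unit datum back to the Néron lattice of `E`; and the transfer to the Manin constant of `E` needs exactly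
one more input, the TWISTED-PERIOD DECOMPOSITION
  (L)  `Λ(f) ⊆ g(χ)·Λ(f_χ) + p·Λ(f)`   (i.e. `p ∤ [Λ(f) : Λ(f) ∩ g(χ)Λ(f_χ)]`),
which is NOT in the tree; it follows from IHARA'S LEMMA (tree fact `ribet1984_iharaLemma`, level `Nq → N`,
non-Eisenstein at `p`): a functional `λ : Λ(f)/p → 𝔽_p` killing `g(χ)Λ(f_χ)` has, by the twisting formula
`(f_χ)_χ = f − a_q f|V_q + q f|V_{q²}` and `T_q`-equivariance, `φ = λ∘{·→∞}_f` invariant under `τ ↦ τ + 1/q`,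
hence extends to a homomorphism on `⟨Γ₀(N), diag(q,1)⁻¹Γ₀(N)diag(q,1)⟩` vanishing on parabolics, i.e. a pair
of functionals on `H₁(X₀(N))` killing the image of `(α_*, β_*) : H₁(X₀(Nq)) → H₁(X₀(N))²` — Eisenstein by
Ihara, so `λ = 0` on the `f`-part. (Seat memo `TDS57-KP-RESIDUE-MEMO.md`, evidence on the item.)

WHAT IS PROVED HERE (the directions of all inclusions, kernel-checked):
* §1 `not_dvd_c_of_twistedPeriodDecomposition` — PURE LATTICE ALGEBRA: a lattice-optimal datum `D₀` of `V₀`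
  (`Λ(V₀) = c₀Λ(f)`), a datum `Dχ` of `Vχ` with `p ∤ c(Dχ)` (`c(Dχ)Λ(g) ⊆ Λ(Vχ)`), a scalar `s` with
  `s·Λ(Vχ) ⊆ Λ(V₀)`, and (L) in the form `Λ(f) ⊆ s·Λ(g) + p·Λ(f)` force `p ∤ c₀`.
* §2 `smul_mem_neronLattice_of_twist` — `s·Λ(Vχ) ⊆ Λ(V₀)` for `s² = q*`, `V₀` good or multiplicative at the
  odd prime `q`, `Vχ` a globally minimal model of `V₀ ⊗ χ_{q*}`: Stevens (5.2), tree theorem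
  `stevens1989_neronLattice_quadraticTwist_oddPrime_holds`.
* §3 `not_dvd_optimal_c_of_kato_of_unitTwist` — **the repair, per curve**: GRANTED F″ and modularity, for
  `V₀/ℚ` globally minimal with a lattice-optimal conductor-level datum `D₀`, `p ∈ {5, 7}`, an odd prime `q`
  at which `V₀` is good or multiplicative, a globally minimal model `Vχ` of `V₀ ⊗ χ_{q*}` which is additive at
  `p` and whose isogeny class has no `ℚ_p`-rational `p`-torsion, and (L) for `f = D₀.f` against every newform
  of `Vχ`: `p ∤ c(D₀)`. (`E^χ[p]` irreducible is derived, `hasIrreducibleModPGaloisRep_of_smul_eq_quadraticTwist`.)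
  `exists_datum_not_dvd_c_of_kato_of_unitTwist` — the same for any minimal member `V ∼ V₀` (transport).
The hypotheses left to the planner as items: (L) [⟸ Ihara + Atkin–Li newness of `f ⊗ χ`]; "no `ℚ_p`
`p`-torsion on the class of `E ⊗ χ` when `(q*/p) = −1` and `E[p]` is irreducible" [elementary]; "additive
reduction at `p` is preserved by a `p`-adic-unit twist" [Tate]; the choice of `q` is Dirichlet
(`Nat.forall_exists_prime_gt_and_eq_mod`).

References: [Stevens1989] Lemma (5.2), (5.4), Thm. (5.1) pp. 96–99; [Ribet1984ICM] Thm. 4.1;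
[DarmonDiamondTaylor1995] Lemma 4.28, §4.5; [Kato2004Asterisque] (8.1.3), Thm. 9.7; [KostersPannekoek2017]
Thm. 1, Cor. 2; [EdixhovenManin1991] §4; [Shimura1971] Prop. 3.64.
-/

set_option autoImplicit false
-- the Theorems directory repeats the summit name (sibling precedent `SignedBaseChangeAssembly.lean`)
set_option linter.dupNamespace false

noncomputable section

open scoped Classical MatrixGroups

open WeierstrassCurve NumberField Literature.NumberTheory.EllipticCurves
  Literature.NumberTheory.EllipticCurves.ModularForms
  Literature.NumberTheory.EllipticCurves.Rank1Residual
  Summit.BirchSwinnertonDyer.Rank1Residual Summit.BirchSwinnertonDyer.BirchSwinnertonDyer.Theorems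
  CongruenceSubgroup

namespace Summit.BirchSwinnertonDyer.BirchSwinnertonDyer.Theorems.TwistDegreeStepFiveSevenUnitTwist

/-- A datum with `p ∤ c` at level `N` is one at any level `M = N`. [folklore] -/
private theorem exists_datum_not_dvd_of_level_eq {W : WeierstrassCurve ℚ} {N M : ℕ} [NeZero N]
    [NeZero M] (h : N = M) {p : ℕ} (D : ModularParametrizationData W N) (hc : ¬ (p : ℤ) ∣ D.c) :
    ∃ D' : ModularParametrizationData W M, ¬ (p : ℤ) ∣ D'.c := by
  subst h
  exact ⟨D, hc⟩

/-! ### §1 Pure lattice algebra: the twisted-period decomposition forces `p ∤ c₀` -/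

/-- **(L) + a Manin-unit datum on the twist side + `s·Λ(Vχ) ⊆ Λ(V₀)` ⟹ `p ∤ c₀`.** Data: a
lattice-optimal datum `D₀` of `V₀` (`Λ(V₀) = c₀·Λ(f)`, `f = D₀.f`), a datum `Dχ` of `Vχ` with
`p ∤ c(Dχ)` (so `c(Dχ)·Λ(g) ⊆ Λ(Vχ)`, `g = Dχ.f`), a scalar `s` with `s·Λ(Vχ) ⊆ Λ(V₀)`, and the
decomposition `Λ(f) ⊆ s·Λ(g) + p·Λ(f)`. Then `c(Dχ)·Λ(f) ⊆ p·Λ(f)`, so `c(Dχ)·ω₁ ∈ p·Λ(V₀)` for a basis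
vector `ω₁` of the period pair `Λ(V₀)`, whence `p ∣ c(Dχ)` if `p ∣ c₀` — contradiction. [folklore] -/
theorem not_dvd_c_of_twistedPeriodDecomposition {V₀ Vχ : WeierstrassCurve ℚ} {N₀ Nχ : ℕ} [NeZero N₀]
    [NeZero Nχ] (D₀ : ModularParametrizationData V₀ N₀) (Dχ : ModularParametrizationData Vχ Nχ)
    {p : ℕ} (hp : p.Prime) (hopt₀ : ∀ z ∈ D₀.L.lattice, ∃ w ∈ periodLattice D₀.f, z = D₀.c * w)
    (hcχ : ¬ (p : ℤ) ∣ Dχ.c) (s : ℂ) (hs : ∀ z ∈ Dχ.L.lattice, s * z ∈ D₀.L.lattice)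
    (hL : ∀ z ∈ periodLattice D₀.f, ∃ w ∈ periodLattice Dχ.f, ∃ y ∈ periodLattice D₀.f,
      z = s * w + (p : ℂ) * y) :
    ¬ (p : ℤ) ∣ D₀.c := by
  rintro ⟨c₁, hc₁⟩
  -- `c(Dχ)·Λ(f) ⊆ p·Λ(f)`
  have key : ∀ z ∈ periodLattice D₀.f, ∃ y' ∈ periodLattice D₀.f, (Dχ.c : ℂ) * z = (p : ℂ) * y' := by
    intro z hz
    obtain ⟨w, hw, y, hy, rfl⟩ := hL z hz
    have h1 : (Dχ.c : ℂ) * w ∈ Dχ.L.lattice := Dχ.smul_periodLattice_le w hw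
    obtain ⟨u, hu, hu'⟩ := hopt₀ _ (hs _ h1)
    refine ⟨c₁ • u + Dχ.c • y, add_mem (zsmul_mem hu _) (zsmul_mem hy _), ?_⟩
    have e1 : (Dχ.c : ℂ) * (s * w + (p : ℂ) * y) = s * ((Dχ.c : ℂ) * w) + (p : ℂ) * ((Dχ.c : ℂ) * y) := by
      ring
    rw [e1, hu', hc₁, zsmul_eq_mul, zsmul_eq_mul]
    push_cast
    ring
  -- the basis vector `ω₁` of `Λ(V₀) = c₀·Λ(f)`
  obtain ⟨z₁, hz₁, hω⟩ := hopt₀ _ D₀.L.ω₁_mem_lattice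
  obtain ⟨y₁, hy₁, hy₁'⟩ := key z₁ hz₁
  have hy₁L : (D₀.c : ℂ) * y₁ ∈ D₀.L.lattice := D₀.smul_periodLattice_le y₁ hy₁
  obtain ⟨m, n, hmn⟩ := PeriodPair.mem_lattice.mp hy₁L
  -- `c(Dχ)·ω₁ = p·(c₀ y₁) = p(m ω₁ + n ω₂)`
  have hrel : (Dχ.c : ℂ) * D₀.L.ω₁ = (p : ℂ) * ((m : ℂ) * D₀.L.ω₁ + (n : ℂ) * D₀.L.ω₂) := by
    rw [hmn, hω, mul_left_comm, hy₁']
    ring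
  -- read `(c(Dχ)/p)·ω₁ + 0·ω₂ ∈ Λ(V₀)` with Mathlib's rationality criterion
  have hp0 : (p : ℚ) ≠ 0 := by exact_mod_cast hp.ne_zero
  have hmem : (((Dχ.c : ℚ) / p : ℚ) : ℂ) * D₀.L.ω₁ + ((0 : ℚ) : ℂ) * D₀.L.ω₂ ∈ D₀.L.lattice := by
    have e : (((Dχ.c : ℚ) / p : ℚ) : ℂ) * D₀.L.ω₁ + ((0 : ℚ) : ℂ) * D₀.L.ω₂ =
        (m : ℂ) * D₀.L.ω₁ + (n : ℂ) * D₀.L.ω₂ := by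
      have hpC : (p : ℂ) ≠ 0 := by exact_mod_cast hp.ne_zero
      push_cast
      rw [zero_mul, add_zero, div_mul_eq_mul_div, div_eq_iff hpC, mul_comm _ (p : ℂ), hrel]
    rw [e]
    exact PeriodPair.mem_lattice.mpr ⟨m, n, rfl⟩
  have hden := (PeriodPair.mul_ω₁_add_mul_ω₂_mem_lattice.mp hmem).1
  -- `den (c/p) = 1` means `p ∣ c`
  apply hcχ
  have hq : ((Dχ.c : ℚ) / p) = (((Dχ.c : ℚ) / p).num : ℚ) := by
    conv_lhs => rw [← Rat.num_div_den ((Dχ.c : ℚ) / p), hden]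
    simp
  refine ⟨((Dχ.c : ℚ) / p).num, ?_⟩
  have : (Dχ.c : ℚ) = (p : ℚ) * (((Dχ.c : ℚ) / p).num : ℚ) := by
    rw [← hq, mul_div_cancel₀ _ hp0]
  exact_mod_cast this

/-! ### §2 Stevens' Lemma (5.2): `s·Λ(Vχ) ⊆ Λ(V₀)` for `s² = q*` -/

/-- **`s·Λ(Vχ) ⊆ Λ(V₀)`** for the Néron lattices carried by any parametrisation data `D₀` of `V₀` and `Dχ`
of `Vχ`, when `V₀` is globally minimal and good or multiplicative at the odd prime `q`, `Vχ` is a globally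
minimal model of `V₀ ⊗ χ_{q*}` and `s² = q*` — Stevens 1989 Lemma (5.2) (`Λ(E^χ) = s⁻¹Λ(E)`), the tree
theorem `stevens1989_neronLattice_quadraticTwist_oddPrime_holds`. [cite: Stevens1989, Lemma (5.2) p. 96] -/
theorem smul_mem_neronLattice_of_twist {V₀ Vχ : WeierstrassCurve ℚ} [V₀.IsElliptic] [V₀.IsGloballyMinimal]
    [Vχ.IsElliptic] [Vχ.IsGloballyMinimal] {N₀ Nχ : ℕ} [NeZero N₀] [NeZero Nχ]
    (D₀ : ModularParametrizationData V₀ N₀) (Dχ : ModularParametrizationData Vχ Nχ)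
    {q : ℕ} [Fact q.Prime] (hq2 : q ≠ 2)
    (hq : V₀.HasGoodReductionAtPrime q ∨ V₀.HasMultiplicativeReductionAtPrime q)
    (v : VariableChange ℚ) (hv : v • V₀.quadraticTwist (((-1 : ℤ) ^ (q / 2) * q : ℤ) : ℚ) = Vχ)
    (s : ℂ) (hs2 : s ^ 2 = (((-1 : ℤ) ^ (q / 2) * q : ℤ) : ℂ)) :
    ∀ z ∈ Dχ.L.lattice, s * z ∈ D₀.L.lattice :=
  fun z hz ↦ (stevens1989_neronLattice_quadraticTwist_oddPrime_holds V₀ D₀.L D₀.isNeronLattice q hq2 hq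
    Vχ ⟨v, hv⟩ Dχ.L Dχ.isNeronLattice s hs2 z).mp hz

/-! ### §3 The repair, per curve, GRANTED F″ -/

section Repair

variable {p : ℕ} [hp : Fact p.Prime]

/-- **Manin's `p`-part at a lattice-optimal datum from an auxiliary unit twist.** GRANTED F″
(`kato_neron_isIntegral_twistedSymbolSum_of_additive_five_le`) and modularity (`exists_isNewformOf`): let
`V₀/ℚ` be globally minimal with `E[p]` irreducible, `p ∈ {5, 7}`, `D₀` a LATTICE-OPTIMAL conductor-level
datum (`Λ(V₀) = c₀Λ(f)`); let `q` be an odd prime at which `V₀` is good or multiplicative, `Vχ` a globally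
minimal model of `V₀ ⊗ χ_{q*}` that is additive at `p` and whose isogeny class has no `ℚ_p`-rational point of
order `p`, `s² = q*`, and assume the twisted-period decomposition (L) `Λ(f) ⊆ s·Λ(g) + p·Λ(f)` for every
newform `g` of `Vχ`. Then `p ∤ c₀`: the tame-twist lever at the optimal curve of the class of `Vχ`
(`ManinFrameResidueProperRTameTwist.exists_member_not_dvd_c_of_tameTwist57`; `E^χ[p]` irreducible by
`hasIrreducibleModPGaloisRep_of_smul_eq_quadraticTwist`), prime-to-`p` transport to `Vχ`, §2 and §1.
CONDITIONAL on F″ and on (L); BSD is not proved by this. [cite: Kato2004Asterisque, (8.1.3) (p. 180), Thm. 9.7 (p. 189)]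
[cite: Stevens1989, Lemma (5.2) p. 96] [cite: Ribet1984ICM, Thm. 4.1] -/
theorem not_dvd_optimal_c_of_kato_of_unitTwist
    (hF : kato_neron_isIntegral_twistedSymbolSum_of_additive_five_le) (hnf : exists_isNewformOf)
    (hp57 : p = 5 ∨ p = 7)
    (V₀ : WeierstrassCurve ℚ) [V₀.IsElliptic] [V₀.IsGloballyMinimal] [NeZero (V₀.conductorNorm ℤ)]
    (hirr : Irr V₀ p) (D₀ : ModularParametrizationData V₀ (V₀.conductorNorm ℤ))
    (hopt₀ : ∀ z ∈ D₀.L.lattice, ∃ w ∈ periodLattice D₀.f, z = D₀.c * w)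
    {q : ℕ} [Fact q.Prime] (hq2 : q ≠ 2)
    (hq : V₀.HasGoodReductionAtPrime q ∨ V₀.HasMultiplicativeReductionAtPrime q)
    (Vχ : WeierstrassCurve ℚ) [Vχ.IsElliptic] [Vχ.IsGloballyMinimal] [NeZero (Vχ.conductorNorm ℤ)]
    (v : VariableChange ℚ) (hv : v • V₀.quadraticTwist (((-1 : ℤ) ^ (q / 2) * q : ℤ) : ℚ) = Vχ)
    (haddχ : Addv Vχ p)
    (hPTχ : ∀ (W' : WeierstrassCurve ℚ) [W'.IsElliptic] [W'.IsGloballyMinimal], IsIsogenous Vχ W' →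
      ∀ P : (W'.baseChange ℚ_[p]).toAffine.Point, p • P = 0 → P = 0)
    (s : ℂ) (hs2 : s ^ 2 = (((-1 : ℤ) ^ (q / 2) * q : ℤ) : ℂ))
    (hL : ∀ (N' : ℕ) [NeZero N'] (g : CuspForm (Gamma0 N') 2), IsNewformOf Vχ g →
      ∀ z ∈ periodLattice D₀.f, ∃ w ∈ periodLattice g, ∃ y ∈ periodLattice D₀.f,
        z = s * w + (p : ℂ) * y) :
    ¬ (p : ℤ) ∣ D₀.c := by
  -- `E^χ[p]` irreducible
  have hd0 : ((((-1 : ℤ) ^ (q / 2) * q : ℤ)) : ℚ) ≠ 0 := by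
    have : ((-1 : ℤ) ^ (q / 2) * q : ℤ) ≠ 0 :=
      mul_ne_zero (pow_ne_zero _ (by norm_num)) (by exact_mod_cast (Fact.out : q.Prime).ne_zero)
    exact_mod_cast this
  have hv' : v⁻¹ • Vχ = V₀.quadraticTwist (((-1 : ℤ) ^ (q / 2) * q : ℤ) : ℚ) := by
    rw [← hv, inv_smul_smul]
  have hirrχ : Irr Vχ p :=
    BurungaleSkinnerTianWan2024.hasIrreducibleModPGaloisRep_of_smul_eq_quadraticTwist V₀ Vχ p hd0 hv' hirr
  -- the lever on the twisted class, transported to `Vχ`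
  obtain ⟨A, hEA, hMA, DA, hisoA, hcA⟩ :=
    ManinFrameResidueProperRTameTwist.exists_member_not_dvd_c_of_tameTwist57 hF hnf Vχ hp57 haddχ hirrχ
      hPTχ
  haveI := hEA
  haveI := hMA
  obtain ⟨Dχ, hcχ⟩ :=
    ManinFrameTransport.exists_modularParametrizationData_not_dvd_of_partner Vχ hp.out hirrχ hisoA DA hcA
  -- Stevens and the lattice algebra
  exact not_dvd_c_of_twistedPeriodDecomposition D₀ Dχ hp.out hopt₀ hcχ s
    (smul_mem_neronLattice_of_twist D₀ Dχ hq2 hq v hv s hs2) (hL _ Dχ.f Dχ.isNewformOf)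

/-- **The same for any globally minimal member `V ∼ V₀` with `E[p]` irreducible**: a conductor-level
datum of `V` with `p ∤ c` (prime-to-`p` transport of the lattice-optimal datum of §3,
`ManinFrameTransport.exists_modularParametrizationData_not_dvd_of_partner`; the level moves by
`N(V) = N(V₀)`). This is the shape KP57♯ asks for. CONDITIONAL on F″ and (L); BSD is not proved by this.
[cite: Stevens1989, Lemma (5.2) p. 96] [cite: JetchevSkinnerWan2017, §7.4.1 and Remark 43] -/
theorem exists_datum_not_dvd_c_of_kato_of_unitTwist
    (hF : kato_neron_isIntegral_twistedSymbolSum_of_additive_five_le) (hnf : exists_isNewformOf)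
    (hp57 : p = 5 ∨ p = 7)
    (V : WeierstrassCurve ℚ) [V.IsElliptic] [V.IsGloballyMinimal] [NeZero (V.conductorNorm ℤ)]
    (hirrV : Irr V p)
    (V₀ : WeierstrassCurve ℚ) [V₀.IsElliptic] [V₀.IsGloballyMinimal] [NeZero (V₀.conductorNorm ℤ)]
    (hiso : IsIsogenous V V₀) (D₀ : ModularParametrizationData V₀ (V₀.conductorNorm ℤ))
    (hopt₀ : ∀ z ∈ D₀.L.lattice, ∃ w ∈ periodLattice D₀.f, z = D₀.c * w)
    {q : ℕ} [Fact q.Prime] (hq2 : q ≠ 2)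
    (hq : V₀.HasGoodReductionAtPrime q ∨ V₀.HasMultiplicativeReductionAtPrime q)
    (Vχ : WeierstrassCurve ℚ) [Vχ.IsElliptic] [Vχ.IsGloballyMinimal] [NeZero (Vχ.conductorNorm ℤ)]
    (v : VariableChange ℚ) (hv : v • V₀.quadraticTwist (((-1 : ℤ) ^ (q / 2) * q : ℤ) : ℚ) = Vχ)
    (haddχ : Addv Vχ p)
    (hPTχ : ∀ (W' : WeierstrassCurve ℚ) [W'.IsElliptic] [W'.IsGloballyMinimal], IsIsogenous Vχ W' →
      ∀ P : (W'.baseChange ℚ_[p]).toAffine.Point, p • P = 0 → P = 0)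
    (s : ℂ) (hs2 : s ^ 2 = (((-1 : ℤ) ^ (q / 2) * q : ℤ) : ℂ))
    (hL : ∀ (N' : ℕ) [NeZero N'] (g : CuspForm (Gamma0 N') 2), IsNewformOf Vχ g →
      ∀ z ∈ periodLattice D₀.f, ∃ w ∈ periodLattice g, ∃ y ∈ periodLattice D₀.f,
        z = s * w + (p : ℂ) * y) :
    ∃ D : ModularParametrizationData V (V.conductorNorm ℤ), ¬ (p : ℤ) ∣ D.c := by
  have hirr₀ : Irr V₀ p := (X12.irr_iff_of_isIsogenous hiso p).mp hirrV
  have hc₀ : ¬ (p : ℤ) ∣ D₀.c :=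
    not_dvd_optimal_c_of_kato_of_unitTwist hF hnf hp57 V₀ hirr₀ D₀ hopt₀ hq2 hq Vχ v hv haddχ hPTχ s hs2 hL
  obtain ⟨D, hc⟩ :=
    ManinFrameTransport.exists_modularParametrizationData_not_dvd_of_partner V hp.out hirrV hiso D₀ hc₀
  have hN : V₀.conductorNorm ℤ = V.conductorNorm ℤ :=
    IsNewformOf.level_eq_conductorNorm_of_exists_isNewformOf hnf D.isNewformOf
  exact exists_datum_not_dvd_of_level_eq hN D hc

end Repair

end Summit.BirchSwinnertonDyer.BirchSwinnertonDyer.Theorems.TwistDegreeStepFiveSevenUnitTwist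

end
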